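import Literature.NumberTheory.LFunctions.Zhang2022.KnifeEdgeEllScales

/-!
# Zhang (2022) §2 at FREE SCALES, II: the REAL-weight polar pairing of `EllScales.discMean` — polarization,
# scaling, and the weighted Cauchy–Schwarz inequality at every scale record (infrastructure; no claim)

Y. Zhang, *Discrete mean estimates and the Landau–Siegel zero*, arXiv:2211.02515v1 [Zhang2022LandauSiegel] — an
unrefereed manuscript under adjudication. **WHAT THIS IS NOT: a claim about its Theorems 1–2, about Landau–Siegel
zeros, or about Parity. The programme SEARCHES and TYPES; no claim about Landau–Siegel zeros, Theorems 1–2 of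
arXiv:2211.02515 or a repaired Margin232 until a kernel theorem says so. Definitions and exact finite algebra only.**

WHY. `KnifeEdgeEllScales` (p456970) gives the free-scale (`P = D^A`) discrete mean `EllScales.discMean c' S F u` with the
REAL weights `Re 𝔠*·Re ω` and the polar pairing `EllScales.discPolar` with the COMPLEX weights `𝔠*·ω` of the
manuscript's `Ξ₁*` (2.17).  The polarization identity `Ξ(u+v) = Ξ(u) + Ξ(v) + 2Re Ξ♭(u,v)` and Cauchy–Schwarz
`|Ξ♭(u,v)|² ≤ Ξ(u)Ξ(v)` (weights `≥ 0`) hold for the REAL-weight pairing `Ξ♭ = discPolarRe` declared here — the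
free-scale twin of `KnifeEdge.discPolar` / `discMean_add` / `norm_sq_discPolar_le` of `KnifeEdgeWallCross` (p459102,
pinned scales) and of `KnifeEdge.discMean_smul` / `discPolar_smul_left/right` of `KnifeEdgeSlotCalculus` (p461073).  A §D
card (edge len or ell) that states a CROSS-term asymptotic at `P = D^A` — in the regime quantifier of record
`∀ A ≥ A₀, ForAllLarge D χ, (A) → ∀ S, S.D = D → S.IsEllRegimeP A → …` (`EllRegimeStatements`) — writes it over
`discPolarRe c' S F (bulk table) (band/overhang table)`; this file supplies the algebra that splits and bounds it.

## References
* Y. Zhang, arXiv:2211.02515v1 (2022), §2 (2.16)–(2.20), Lemma 2.3, (2.15). [cite: Zhang2022LandauSiegel, §2]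
-/

noncomputable section

open Complex Real ComplexConjugate

namespace Literature.NumberTheory.LFunctions.Zhang2022.EllScales

variable (c' : ℝ) (S : Scales) (F : Finset (Chr S))

/-- **The polar pairing of `EllScales.discMean` with its REAL weights**:
`Ξ♭_F(u,v) = Σ_{ψ∈F} Σ_{ρ∈𝔷(ψ)} (Re 𝔠*(ρ,ψ)·Re ω(ρ))·u(ψ,ρ)·conj v(ψ,ρ)` (diagonal = `discMean`, `discPolarRe_self_re`;
the complex-weight pairing of (2.17) is `EllScales.discPolar`). [cite: Zhang2022LandauSiegel, §2 (2.16)–(2.17)] -/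
def discPolarRe (u v : Chr S → ℂ → ℂ) : ℂ :=
  ∑ x ∈ F, ∑ ρ ∈ Skeleton.finsetOf (zeroSet x),
    (((cstar c' S x ρ).re * (omegaW S ρ).re : ℝ) : ℂ) * (u x ρ * conj (v x ρ))

variable {c' S F}

/-- `Re Ξ♭(u,u) = Ξ(u)`. [cite: Zhang2022LandauSiegel, §2 (2.16)–(2.17)] -/
theorem discPolarRe_self_re (u : Chr S → ℂ → ℂ) : (discPolarRe c' S F u u).re = discMean c' S F u := by
  unfold discPolarRe discMean
  rw [Complex.re_sum]
  refine Finset.sum_congr rfl fun x _ => ?_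
  rw [Complex.re_sum]
  refine Finset.sum_congr rfl fun ρ _ => ?_
  rw [Complex.re_ofReal_mul, Complex.mul_conj, Complex.ofReal_re, ← Complex.sq_norm]
  ring

/-- **Polarization at scale `S`:** `Ξ(u + v) = Ξ(u) + Ξ(v) + 2Re Ξ♭(u,v)` (finite algebra, every scale record, no
hypothesis on the weights). [cite: Zhang2022LandauSiegel, §2 (2.16)–(2.17)] -/
theorem discMean_add (u v : Chr S → ℂ → ℂ) :
    discMean c' S F (fun x s => u x s + v x s) = discMean c' S F u + discMean c' S F v + 2 * (discPolarRe c' S F u v).re := by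
  unfold discMean discPolarRe
  rw [Complex.re_sum, Finset.mul_sum, ← Finset.sum_add_distrib, ← Finset.sum_add_distrib]
  refine Finset.sum_congr rfl fun x _ => ?_
  rw [Complex.re_sum, Finset.mul_sum, ← Finset.sum_add_distrib, ← Finset.sum_add_distrib]
  refine Finset.sum_congr rfl fun ρ _ => ?_
  rw [Complex.re_ofReal_mul, Complex.sq_norm, Complex.sq_norm, Complex.sq_norm, Complex.normSq_add]
  ring

/-- `Ξ(a·u) = |a|²·Ξ(u)`. [cite: Zhang2022LandauSiegel, §2 (2.16)] -/
theorem discMean_smul (a : ℂ) (u : Chr S → ℂ → ℂ) :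
    discMean c' S F (fun x s => a * u x s) = ‖a‖ ^ 2 * discMean c' S F u := by
  unfold discMean
  rw [Finset.mul_sum]
  refine Finset.sum_congr rfl fun x _ => ?_
  rw [Finset.mul_sum]
  refine Finset.sum_congr rfl fun ρ _ => ?_
  rw [norm_mul, mul_pow]
  ring

/-- `Ξ♭(a·u, v) = a·Ξ♭(u,v)`. [cite: Zhang2022LandauSiegel, §2 (2.17)] -/
theorem discPolarRe_smul_left (a : ℂ) (u v : Chr S → ℂ → ℂ) :
    discPolarRe c' S F (fun x s => a * u x s) v = a * discPolarRe c' S F u v := by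
  unfold discPolarRe
  rw [Finset.mul_sum]
  refine Finset.sum_congr rfl fun x _ => ?_
  rw [Finset.mul_sum]
  refine Finset.sum_congr rfl fun ρ _ => ?_
  ring

/-- `Ξ♭(u, a·v) = ā·Ξ♭(u,v)`. [cite: Zhang2022LandauSiegel, §2 (2.17)] -/
theorem discPolarRe_smul_right (a : ℂ) (u v : Chr S → ℂ → ℂ) :
    discPolarRe c' S F u (fun x s => a * v x s) = conj a * discPolarRe c' S F u v := by
  unfold discPolarRe
  rw [Finset.mul_sum]
  refine Finset.sum_congr rfl fun x _ => ?_
  rw [Finset.mul_sum]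
  refine Finset.sum_congr rfl fun ρ _ => ?_
  rw [map_mul]
  ring

/-- **Polarization with an amplitude:** `Ξ(s·u + v) = |s|²Ξ(u) + Ξ(v) + 2Re(s·Ξ♭(u,v))` — the free-scale twin of
`KnifeEdge.discMean_add` ∘ `discMean_smul` (the two-piece / bulk ⊕ band bookkeeping at `P = D^A`).
[cite: Zhang2022LandauSiegel, §2 (2.16)–(2.17), §7 (7.2)] -/
theorem discMean_smul_add (s : ℂ) (u v : Chr S → ℂ → ℂ) :
    discMean c' S F (fun x t => s * u x t + v x t)
      = ‖s‖ ^ 2 * discMean c' S F u + discMean c' S F v + 2 * (s * discPolarRe c' S F u v).re := by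
  rw [discMean_add (fun x t => s * u x t) v, discMean_smul, discPolarRe_smul_left]

/-- The discrete mean as ONE sum over the index set `Σ_{ψ∈F} 𝔷(ψ)` (for Cauchy–Schwarz). [cite: Zhang2022LandauSiegel, §2 (2.16)] -/
theorem discMean_eq_sum_sigma (u : Chr S → ℂ → ℂ) :
    discMean c' S F u = ∑ i ∈ F.sigma (fun x => Skeleton.finsetOf (zeroSet x)),
      (cstar c' S i.1 i.2).re * ‖u i.1 i.2‖ ^ 2 * (omegaW S i.2).re := by
  unfold discMean
  rw [Finset.sum_sigma]

/-- The polar pairing as ONE sum over `Σ_{ψ∈F} 𝔷(ψ)`. [cite: Zhang2022LandauSiegel, §2 (2.17)] -/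
theorem discPolarRe_eq_sum_sigma (u v : Chr S → ℂ → ℂ) :
    discPolarRe c' S F u v = ∑ i ∈ F.sigma (fun x => Skeleton.finsetOf (zeroSet x)),
      (((cstar c' S i.1 i.2).re * (omegaW S i.2).re : ℝ) : ℂ) * (u i.1 i.2 * conj (v i.1 i.2)) := by
  unfold discPolarRe
  rw [Finset.sum_sigma]

/-- **Weighted Cauchy–Schwarz at scale `S`:** with weights `Re 𝔠*·Re ω ≥ 0` on `Σ_{ψ∈F} 𝔷(ψ)` (Lemma 2.3's output on
the sampled zeros), `|Ξ♭(u,v)|² ≤ Ξ(u)·Ξ(v)` — every scale record, arbitrary value tables, no asymptotics (the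
free-scale twin of `KnifeEdge.norm_sq_discPolar_le`, whose proof pattern is followed).
[cite: Zhang2022LandauSiegel, §2 Lemma 2.3, (2.15)–(2.17)] -/
theorem norm_sq_discPolarRe_le
    (hw : ∀ x ∈ F, ∀ ρ ∈ Skeleton.finsetOf (zeroSet x), 0 ≤ (cstar c' S x ρ).re * (omegaW S ρ).re)
    (u v : Chr S → ℂ → ℂ) :
    ‖discPolarRe c' S F u v‖ ^ 2 ≤ discMean c' S F u * discMean c' S F v := by
  set I := F.sigma (fun x => Skeleton.finsetOf (zeroSet x)) with hI
  set w : ((_ : Chr S) × ℂ) → ℝ := fun i => (cstar c' S i.1 i.2).re * (omegaW S i.2).re with hw_def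
  have hwI : ∀ i ∈ I, 0 ≤ w i := fun i hi => by
    obtain ⟨hx, hρ⟩ := Finset.mem_sigma.mp hi
    exact hw i.1 hx i.2 hρ
  rw [discPolarRe_eq_sum_sigma, discMean_eq_sum_sigma, discMean_eq_sum_sigma]
  have h1 : ‖∑ i ∈ I, ((w i : ℝ) : ℂ) * (u i.1 i.2 * conj (v i.1 i.2))‖ ≤ ∑ i ∈ I, w i * ‖u i.1 i.2‖ * ‖v i.1 i.2‖ := by
    refine (norm_sum_le _ _).trans (le_of_eq (Finset.sum_congr rfl fun i hi => ?_))
    rw [norm_mul, norm_mul, Complex.norm_real, Real.norm_eq_abs, abs_of_nonneg (hwI i hi), Complex.norm_conj]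
    ring
  have h2 : (∑ i ∈ I, w i * ‖u i.1 i.2‖ * ‖v i.1 i.2‖) ^ 2 ≤
      (∑ i ∈ I, w i * ‖u i.1 i.2‖ ^ 2) * ∑ i ∈ I, w i * ‖v i.1 i.2‖ ^ 2 := by
    refine Finset.sum_sq_le_sum_mul_sum_of_sq_le_mul I
      (fun i hi => mul_nonneg (hwI i hi) (sq_nonneg _)) (fun i hi => mul_nonneg (hwI i hi) (sq_nonneg _))
      (fun i _ => le_of_eq ?_)
    ring
  have h3 : ‖∑ i ∈ I, ((w i : ℝ) : ℂ) * (u i.1 i.2 * conj (v i.1 i.2))‖ ^ 2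
      ≤ (∑ i ∈ I, w i * ‖u i.1 i.2‖ * ‖v i.1 i.2‖) ^ 2 := pow_le_pow_left₀ (norm_nonneg _) h1 2
  have hu : ∑ i ∈ I, w i * ‖u i.1 i.2‖ ^ 2 = ∑ i ∈ I, (cstar c' S i.1 i.2).re * ‖u i.1 i.2‖ ^ 2 * (omegaW S i.2).re :=
    Finset.sum_congr rfl fun i _ => by simp only [hw_def]; ring
  have hv : ∑ i ∈ I, w i * ‖v i.1 i.2‖ ^ 2 = ∑ i ∈ I, (cstar c' S i.1 i.2).re * ‖v i.1 i.2‖ ^ 2 * (omegaW S i.2).re :=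
    Finset.sum_congr rfl fun i _ => by simp only [hw_def]; ring
  calc ‖∑ i ∈ I, ((w i : ℝ) : ℂ) * (u i.1 i.2 * conj (v i.1 i.2))‖ ^ 2
      ≤ (∑ i ∈ I, w i * ‖u i.1 i.2‖ * ‖v i.1 i.2‖) ^ 2 := h3
    _ ≤ (∑ i ∈ I, w i * ‖u i.1 i.2‖ ^ 2) * ∑ i ∈ I, w i * ‖v i.1 i.2‖ ^ 2 := h2
    _ = _ := by rw [hu, hv]

/-- **The Cauchy–Schwarz floor at scale `S`:** with weights `≥ 0`, `Ξ(u + v) ≥ (√Ξ(u) − √Ξ(v))²` — a cross term lowers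
the mean of a composite design at most to the floor (the (B1) reading «bulk ⊕ band», free scales).
[cite: Zhang2022LandauSiegel, §2 Lemma 2.3, (2.15)–(2.17)] -/
theorem sq_sqrt_sub_sqrt_le_discMean_add
    (hw : ∀ x ∈ F, ∀ ρ ∈ Skeleton.finsetOf (zeroSet x), 0 ≤ (cstar c' S x ρ).re * (omegaW S ρ).re)
    (u v : Chr S → ℂ → ℂ) :
    (Real.sqrt (discMean c' S F u) - Real.sqrt (discMean c' S F v)) ^ 2 ≤ discMean c' S F (fun x s => u x s + v x s) := by
  have hU : 0 ≤ discMean c' S F u := by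
    rw [discMean_eq_sum_sigma]
    exact Finset.sum_nonneg fun i hi => by
      obtain ⟨hx, hρ⟩ := Finset.mem_sigma.mp hi
      have := hw i.1 hx i.2 hρ
      nlinarith [sq_nonneg ‖u i.1 i.2‖, mul_nonneg this (sq_nonneg ‖u i.1 i.2‖)]
  have hV : 0 ≤ discMean c' S F v := by
    rw [discMean_eq_sum_sigma]
    exact Finset.sum_nonneg fun i hi => by
      obtain ⟨hx, hρ⟩ := Finset.mem_sigma.mp hi
      have := hw i.1 hx i.2 hρ
      nlinarith [sq_nonneg ‖v i.1 i.2‖, mul_nonneg this (sq_nonneg ‖v i.1 i.2‖)]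
  have hcs := norm_sq_discPolarRe_le hw u v
  rw [discMean_add]
  -- (√U − √V)² = U + V − 2√U√V and |Re Ξ♭| ≤ ‖Ξ♭‖ ≤ √U√V
  have hre : |(discPolarRe c' S F u v).re| ≤ Real.sqrt (discMean c' S F u) * Real.sqrt (discMean c' S F v) := by
    refine (Complex.abs_re_le_norm _).trans ?_
    rw [← Real.sqrt_mul hU, ← Real.sqrt_sq (norm_nonneg _)]
    exact Real.sqrt_le_sqrt hcs
  have hsq : (Real.sqrt (discMean c' S F u) - Real.sqrt (discMean c' S F v)) ^ 2
      = discMean c' S F u + discMean c' S F v - 2 * (Real.sqrt (discMean c' S F u) * Real.sqrt (discMean c' S F v)) := by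
    rw [sub_sq, Real.sq_sqrt hU, Real.sq_sqrt hV]; ring
  rw [hsq]
  have := (abs_le.mp hre).1
  linarith

end Literature.NumberTheory.LFunctions.Zhang2022.EllScales

end
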